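import Mathlib.NumberTheory.Height.MvPolynomial
import HarnessLib

/-!
# Heights under polynomial maps with integer coefficients: the constants grow like `C^{[K:ℚ]}`

Auxiliary height-machine file (used by the abc-iut campaign-S chain ([IUTchIV] Cor. 2.2 (i): comparing `ht_∞ ≈ h(j(λ))` with
`6·ht_{ω_X(D)} ≈ 6·h(λ)`)). Mathlib (`Mathlib.NumberTheory.Height.MvPolynomial`) proves, for a family `p` of
homogeneous polynomials of degree `N` over a field `K` with admissible absolute values,
`logHeight (p(x)) ≤ log (max (mulHeightBound p) 1) + N·logHeight x` and, given a Nullstellensatz certificate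
`q`, `−log (#ι'^{totalWeight K} · max (mulHeightBound q) 1) + N·logHeight x ≤ logHeight (p(x))`. To use these
UNIFORMLY over all number fields (our points have varying fields of definition) one needs the constant
`mulHeightBound` to be `≤ C^{totalWeight K}` with `C` independent of `K`. This file proves exactly that for
families of binary forms (two variables) with INTEGER coefficients: if every `p j` is homogeneous of degree `N`
and every coefficient is (the image of) an integer of absolute value `≤ B` (`B ≥ 1`), then
`mulHeightBound p ≤ ((N+1)·B)^{totalWeight K}` (`mulHeightBound_le_of_intCoeff`), whence
`log (max (mulHeightBound p) 1) ≤ totalWeight K · log ((N+1)·B)`. Ingredients: an absolute value satisfies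
`v(n) ≤ n` on naturals and, if nonarchimedean, `v(n) ≤ 1`; a homogeneous binary form of degree `N` has at most
`N+1` monomials. [cite: HindrySilverman2000, Thm B.2.5]
-/

noncomputable section

namespace Literature.NumberTheory.DiophantineGeometry

namespace IntegerForms

open MvPolynomial Height AdmissibleAbsValues Multiset Finset

variable {K : Type*} [Field K]

/-! ## Absolute values on integers -/

/-- `v(n) ≤ n` for every absolute value and natural number `n`. [folklore] -/
private theorem absval_natCast_le (v : AbsoluteValue K ℝ) (n : ℕ) : v (n : K) ≤ n := by
  induction n with
  | zero => simp
  | succ k ih =>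
    calc v ((k + 1 : ℕ) : K) = v ((k : K) + 1) := by push_cast; rfl
      _ ≤ v (k : K) + v 1 := v.add_le _ _
      _ ≤ k + 1 := by rw [v.map_one]; linarith
      _ = ((k + 1 : ℕ) : ℝ) := by push_cast; rfl

/-- `v(z) ≤ |z|` for every absolute value and integer `z`. [folklore] -/
private theorem absval_intCast_le (v : AbsoluteValue K ℝ) (z : ℤ) : v (z : K) ≤ |(z : ℝ)| := by
  obtain ⟨n, rfl | rfl⟩ := z.eq_nat_or_neg
  · simpa using absval_natCast_le v n
  · rw [Int.cast_neg, v.map_neg, Int.cast_neg, abs_neg]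
    simpa using absval_natCast_le v n

/-- A nonarchimedean absolute value is `≤ 1` on naturals. [folklore] -/
private theorem nonarch_natCast_le_one {v : AbsoluteValue K ℝ} (hv : IsNonarchimedean v) (n : ℕ) :
    v (n : K) ≤ 1 := by
  induction n with
  | zero => simp
  | succ k ih =>
    calc v ((k + 1 : ℕ) : K) = v ((k : K) + 1) := by push_cast; rfl
      _ ≤ max (v (k : K)) (v 1) := hv _ _
      _ ≤ 1 := by rw [v.map_one]; exact max_le ih le_rfl

/-- A nonarchimedean absolute value is `≤ 1` on integers. [folklore] -/
private theorem nonarch_intCast_le_one {v : AbsoluteValue K ℝ} (hv : IsNonarchimedean v) (z : ℤ) :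
    v (z : K) ≤ 1 := by
  obtain ⟨n, rfl | rfl⟩ := z.eq_nat_or_neg
  · simpa using nonarch_natCast_le_one hv n
  · rw [Int.cast_neg, v.map_neg]; simpa using nonarch_natCast_le_one hv n

/-! ## Binary forms with bounded integer coefficients -/

/-- A family `p : ι' → K[X₀, X₁]` of binary forms of degree `N` whose coefficients are images of integers of
absolute value `≤ B` (the data entering the constant of Hindry–Silverman's Thm. B.2.5, `h(φ(P)) = d·h(P) + O(1)`).
[cite: HindrySilverman2000, Thm B.2.5] -/
structure IntCoeffBound {ι' : Type*} (p : ι' → MvPolynomial (Fin 2) K) (N B : ℕ) : Prop where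
  /-- each `p j` is homogeneous of degree `N` -/
  homog : ∀ j, (p j).IsHomogeneous N
  /-- each coefficient is an integer of absolute value `≤ B` -/
  coeff_int : ∀ j s, ∃ z : ℤ, coeff s (p j) = (z : K) ∧ |z| ≤ B

/-- The `N+1` exponent vectors `(i, N−i)` of degree `N` in two variables. [folklore] -/
def expo (N i : ℕ) : Fin 2 →₀ ℕ := Finsupp.single 0 i + Finsupp.single 1 (N - i)

/-- Every exponent vector of degree `N` in two variables is one of the `expo N i`, `i ≤ N`. [folklore] -/
private theorem mem_image_expo {N : ℕ} {s : Fin 2 →₀ ℕ} (hs : s.degree = N) :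
    s ∈ (Finset.range (N + 1)).image (expo N) := by
  rw [Finset.mem_image]
  have hsum : s 0 + s 1 = N := by
    rw [← hs, Finsupp.degree_eq_sum, Fin.sum_univ_two]
  refine ⟨s 0, Finset.mem_range.mpr (by omega), ?_⟩
  ext i
  fin_cases i
  · simp [expo]
  · simp [expo]; omega

/-- The support of a binary form of degree `N` has at most `N+1` elements. [folklore] -/
private theorem card_support_le {N : ℕ} {p : MvPolynomial (Fin 2) K} (hp : p.IsHomogeneous N) :
    p.support.card ≤ N + 1 := by
  have hsub : p.support ⊆ (Finset.range (N + 1)).image (expo N) := by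
    intro s hs
    have hc : coeff s p ≠ 0 := mem_support_iff.mp hs
    have hdeg : s.degree = N := by
      rw [Finsupp.degree_eq_weight_one]; exact hp hc
    exact mem_image_expo hdeg
  calc p.support.card ≤ ((Finset.range (N + 1)).image (expo N)).card := Finset.card_le_card hsub
    _ ≤ (Finset.range (N + 1)).card := Finset.card_image_le
    _ = N + 1 := Finset.card_range _

variable {ι' : Type*} {p : ι' → MvPolynomial (Fin 2) K} {N B : ℕ}

/-- Archimedean-type local factor: `Σ_{s ∈ supp} v(coeff s (p j)) ≤ (N+1)·B`. [folklore] -/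
private theorem coeffSum_le (h : IntCoeffBound p N B) (v : AbsoluteValue K ℝ) (j : ι') :
    (AddMonoidAlgebra.coeff (p j)).sum (fun _ c => v c) ≤ ((N : ℝ) + 1) * B := by
  rw [MvPolynomial.sum_def]
  have hterm : ∀ s ∈ (p j).support, v ((p j).coeff s) ≤ (B : ℝ) := by
    intro s _
    obtain ⟨z, hz, hzB⟩ := h.coeff_int j s
    rw [hz]
    calc v (z : K) ≤ |(z : ℝ)| := absval_intCast_le v z
      _ ≤ B := by exact_mod_cast hzB
  calc ∑ s ∈ (p j).support, v ((p j).coeff s) ≤ ∑ _s ∈ (p j).support, (B : ℝ) := Finset.sum_le_sum hterm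
    _ = (p j).support.card * B := by rw [Finset.sum_const, nsmul_eq_mul]
    _ ≤ ((N : ℝ) + 1) * B := by
        have hc : ((p j).support.card : ℝ) ≤ N + 1 := by exact_mod_cast card_support_le (h.homog j)
        exact mul_le_mul_of_nonneg_right hc (Nat.cast_nonneg B)

/-- Nonarchimedean local factor: `⨆_j max (⨆_{s} v(coeff s (p j))) 1 = 1`. [folklore] -/
private theorem nonarchFactor_eq_one [Nonempty ι'] (h : IntCoeffBound p N B) {v : AbsoluteValue K ℝ}
    (hv : IsNonarchimedean v) :
    (⨆ j, max (⨆ s : (p j).support, v (coeff s (p j))) 1) = 1 := by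
  have hj : ∀ j, max (⨆ s : (p j).support, v (coeff s (p j))) 1 = 1 := by
    intro j
    refine max_eq_right (Real.iSup_le (fun s => ?_) zero_le_one)
    obtain ⟨z, hz, -⟩ := h.coeff_int j s
    rw [hz]
    exact nonarch_intCast_le_one hv z
  simp_rw [hj]
  exact ciSup_const

variable [AdmissibleAbsValues K]

/-- **The height constant of an integer-coefficient family of binary forms is `≤ ((N+1)B)^{totalWeight K}`**
(the explicit `O(1)` of Hindry–Silverman Thm. B.2.5 for integer forms, uniform in the number field).
[cite: HindrySilverman2000, Thm B.2.5] -/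
theorem mulHeightBound_le_of_intCoeff [Nonempty ι'] [Finite ι'] (h : IntCoeffBound p N B) :
    mulHeightBound p ≤ (((N : ℝ) + 1) * B) ^ totalWeight K := by
  rw [mulHeightBound_eq]
  -- nonarchimedean part is `1`
  have hna : (∏ᶠ v : nonarchAbsVal (K := K), ⨆ j, max (⨆ s : (p j).support, v.val (coeff s (p j))) 1) = 1 :=
    finprod_eq_one_of_forall_eq_one fun v => nonarchFactor_eq_one h (isNonarchimedean _ v.prop)
  rw [hna, mul_one]
  -- archimedean part: each factor `≤ (N+1)B`, and there are `totalWeight K` of them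
  have hfac : ∀ v ∈ archAbsVal (K := K),
      (⨆ j, (AddMonoidAlgebra.coeff (p j)).sum (fun _ c => v c)) ≤ ((N : ℝ) + 1) * B :=
    fun v _ => ciSup_le fun j => coeffSum_le h v j
  have hnn : ∀ v ∈ archAbsVal (K := K),
      0 ≤ (⨆ j, (AddMonoidAlgebra.coeff (p j)).sum (fun _ c => v c)) := by
    intro v _
    refine Real.iSup_nonneg fun j => ?_
    rw [MvPolynomial.sum_def]
    exact Finset.sum_nonneg fun s _ => v.nonneg _
  calc (archAbsVal.map fun v => ⨆ j, (AddMonoidAlgebra.coeff (p j)).sum (fun _ c => v c)).prod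
      ≤ (archAbsVal.map fun _ => ((N : ℝ) + 1) * B).prod :=
        prod_map_le_prod_map₀ _ _ hnn hfac
    _ = (((N : ℝ) + 1) * B) ^ totalWeight K := by
        rw [Multiset.map_const', Multiset.prod_replicate, totalWeight]

/-- Logarithmic form: `log (max (mulHeightBound p) 1) ≤ totalWeight K · log((N+1)·B)` for `B ≥ 1`.
[cite: HindrySilverman2000, Thm B.2.5] -/
theorem log_mulHeightBound_le_of_intCoeff [Nonempty ι'] [Finite ι'] (h : IntCoeffBound p N B) (hB : 1 ≤ B) :
    Real.log (max (mulHeightBound p) 1) ≤ totalWeight K * Real.log (((N : ℝ) + 1) * B) := by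
  have hC : (1 : ℝ) ≤ ((N : ℝ) + 1) * B := by
    have : (1 : ℝ) ≤ B := by exact_mod_cast hB
    nlinarith
  have h1 : max (mulHeightBound p) 1 ≤ (((N : ℝ) + 1) * B) ^ totalWeight K :=
    max_le (mulHeightBound_le_of_intCoeff h) (one_le_pow₀ hC)
  have hpos : 0 < max (mulHeightBound p) 1 := lt_of_lt_of_le one_pos (le_max_right _ _)
  calc Real.log (max (mulHeightBound p) 1) ≤ Real.log ((((N : ℝ) + 1) * B) ^ totalWeight K) :=
        Real.log_le_log hpos h1
    _ = totalWeight K * Real.log (((N : ℝ) + 1) * B) := by rw [Real.log_pow]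

/-! ## Heights of tuples of natural numbers -/

omit [AdmissibleAbsValues K] in
/-- For a nonarchimedean `v` and a tuple of naturals containing `1`, `⨆_i v(n_i) = 1`. [folklore] -/
private theorem iSup_nonarch_natTuple_eq_one {ι : Type*} [Finite ι] {v : AbsoluteValue K ℝ}
    (hv : IsNonarchimedean v) (n : ι → ℕ) {i₀ : ι} (h1 : n i₀ = 1) :
    (⨆ i, v ((n i : ℕ) : K)) = 1 := by
  have : Nonempty ι := ⟨i₀⟩
  refine le_antisymm (ciSup_le fun i => nonarch_natCast_le_one hv (n i)) ?_
  have h := Finite.le_ciSup (fun i => v ((n i : ℕ) : K)) i₀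
  simp only [h1, Nat.cast_one, map_one] at h
  exact h

/-- **Height of a tuple of natural numbers**: if `x_i = n_i ∈ ℕ` with some `n_{i₀} = 1` and all `n_i ≤ M`,
then `logHeight x ≤ totalWeight K · log M` (arch factors `≤ M`, nonarch factors `= 1`; cf. the height of a
point with coprime integer coordinates, Hindry–Silverman §B.2). [cite: HindrySilverman2000, §B.2] -/
theorem logHeight_natTuple_le {ι : Type*} [Finite ι] (n : ι → ℕ) {i₀ : ι} (h1 : n i₀ = 1) {M : ℕ}
    (hM : ∀ i, n i ≤ M) : logHeight (fun i => ((n i : ℕ) : K)) ≤ totalWeight K * Real.log M := by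
  have : Nonempty ι := ⟨i₀⟩
  have hM1 : (1 : ℝ) ≤ M := by have := hM i₀; rw [h1] at this; exact_mod_cast this
  have hx : (fun i => ((n i : ℕ) : K)) ≠ 0 := by
    intro h; have := congrFun h i₀; simp [h1] at this
  rw [logHeight_eq_log_mulHeight, mulHeight_eq hx]
  have hna : (∏ᶠ v : nonarchAbsVal (K := K), ⨆ i, v.val ((n i : ℕ) : K)) = 1 :=
    finprod_eq_one_of_forall_eq_one fun v => iSup_nonarch_natTuple_eq_one (isNonarchimedean _ v.prop) n h1
  rw [hna, mul_one]
  have harch : (archAbsVal.map fun v : AbsoluteValue K ℝ => ⨆ i, v ((n i : ℕ) : K)).prod ≤ (M : ℝ) ^ totalWeight K := by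
    calc (archAbsVal.map fun v : AbsoluteValue K ℝ => ⨆ i, v ((n i : ℕ) : K)).prod
        ≤ (archAbsVal.map fun _ => (M : ℝ)).prod :=
          prod_map_le_prod_map₀ _ _ (fun v _ => Real.iSup_nonneg fun i => v.nonneg _)
            (fun v _ => ciSup_le fun i => le_trans (absval_natCast_le v (n i)) (by exact_mod_cast hM i))
      _ = (M : ℝ) ^ totalWeight K := by rw [Multiset.map_const', Multiset.prod_replicate, totalWeight]
  have hpos : 0 < (archAbsVal.map fun v : AbsoluteValue K ℝ => ⨆ i, v ((n i : ℕ) : K)).prod := by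
    have := one_le_mulHeight (fun i => ((n i : ℕ) : K))
    rw [mulHeight_eq hx, hna, mul_one] at this
    linarith
  calc Real.log (archAbsVal.map fun v : AbsoluteValue K ℝ => ⨆ i, v ((n i : ℕ) : K)).prod
      ≤ Real.log ((M : ℝ) ^ totalWeight K) := Real.log_le_log hpos harch
    _ = totalWeight K * Real.log M := by rw [Real.log_pow]

/-! ## Binary forms given by explicit integer coefficient lists -/

omit [AdmissibleAbsValues K] in
/-- The binary form `Σ_{i ∈ S} c_i · X₀^{e_i,0} X₁^{e_i,1}` with integer coefficients `c_i` at the exponent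
vectors `e_i`. [folklore] -/
def ofIntCoeffs (S : Finset ℕ) (e : ℕ → Fin 2 →₀ ℕ) (c : ℕ → ℤ) : MvPolynomial (Fin 2) K :=
  ∑ i ∈ S, monomial (e i) ((c i : ℤ) : K)

omit [AdmissibleAbsValues K] in
/-- Its coefficients are integers: `coeff s = Σ_{i : e_i = s} c_i`. [folklore] -/
private theorem coeff_ofIntCoeffs (S : Finset ℕ) (e : ℕ → Fin 2 →₀ ℕ) (c : ℕ → ℤ) (s : Fin 2 →₀ ℕ) :
    coeff s (ofIntCoeffs (K := K) S e c) = ((∑ i ∈ S with e i = s, c i : ℤ) : K) := by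
  classical
  unfold ofIntCoeffs
  rw [coeff_sum, Finset.sum_filter]
  push_cast
  refine Finset.sum_congr rfl fun i _ => ?_
  rw [coeff_monomial]

omit [AdmissibleAbsValues K] in
/-- It is homogeneous of degree `N` if all exponent vectors have degree `N` (a form of degree `N` in the sense
of Hindry–Silverman §B.2). [cite: HindrySilverman2000, §B.2] -/
theorem isHomogeneous_ofIntCoeffs (S : Finset ℕ) (e : ℕ → Fin 2 →₀ ℕ) (c : ℕ → ℤ) {N : ℕ}
    (he : ∀ i ∈ S, (e i).degree = N) : (ofIntCoeffs (K := K) S e c).IsHomogeneous N := by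
  unfold ofIntCoeffs
  exact IsHomogeneous.sum _ _ _ fun i hi => isHomogeneous_monomial _ (he i hi)

omit [AdmissibleAbsValues K] in
/-- Coefficient bound: each coefficient is an integer of absolute value `≤ Σ_i |c_i|` (so `IntCoeffBound`
applies with `B = Σ_i |c_i|`). [cite: HindrySilverman2000, Thm B.2.5] -/
theorem coeff_ofIntCoeffs_bound (S : Finset ℕ) (e : ℕ → Fin 2 →₀ ℕ) (c : ℕ → ℤ) (s : Fin 2 →₀ ℕ)
    {B : ℕ} (hB : ∑ i ∈ S, |c i| ≤ B) :
    ∃ z : ℤ, coeff s (ofIntCoeffs (K := K) S e c) = (z : K) ∧ |z| ≤ B := by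
  classical
  refine ⟨∑ i ∈ S with e i = s, c i, coeff_ofIntCoeffs S e c s, ?_⟩
  calc |∑ i ∈ S with e i = s, c i| ≤ ∑ i ∈ S with e i = s, |c i| := Finset.abs_sum_le_sum_abs _ _
    _ ≤ ∑ i ∈ S, |c i| := Finset.sum_le_sum_of_subset_of_nonneg (Finset.filter_subset _ _)
        (fun i _ _ => abs_nonneg _)
    _ ≤ B := hB

end IntegerForms

end Literature.NumberTheory.DiophantineGeometry

end
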